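import Literature.Geometry.Riemannian.AHNormalizationOffBoundary
import Literature.Geometry.Riemannian.GradientEstimateIntegration
import Mathlib.Analysis.SpecialFunctions.Log.Deriv
import HarnessLib

/-!
# Distance function vs. defining function on a conformally compact filling: the lower bound

Support file (everything proved, no definitions, no named facts) for the proof of
`Literature.Geometry.Riemannian.liQingShi_pinching_five` (Li–Qing–Shi 2017, Thm. 1.8). In the
proof of Thm. 1.5/1.8 there (p. 11) the distance function `t = dist_{g⁺}(p₀, ·)` of the complete
metric is compared with `r = −log (x/2)`, `x` the (geodesic) boundary defining function: "it is
easily seen that `u = r − t` is bounded on `Xⁿ` by the triangle inequality". In the tree's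
filling package (`Literature.Geometry.Riemannian.IsConformallyCompactFillingOfDim`: a smooth
embedding `j : N → X` onto the interior of the compact `X`, `ρ ≥ 0` smooth vanishing exactly on
`∂X`, `j^* ḡ = (ρ ∘ j)² g`, `|dρ|_ḡ = 1` ON `∂X`) the defining function is not geodesic, and
this file proves the half `t ≥ r − C` of the comparison from the propagated normalisation
`|dρ|_ḡ ≤ 1 + O(ρ)` (`ConformallyCompact.exists_normalization_off_boundary`):

* `mvfderiv_comp_apply_of_hasDerivAt` — chain rule `d(F ∘ u)_x v = F'(u x) · du_x v` for a real
  function of a real function on a manifold.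
* `exists_log_sub_log_sub_le_edist` — **`log ρ(j p) − log ρ(j q) ≤ d_g(p, q) + C`** for all bulk
  points `p, q`, with one constant `C` (so `t = d_g(p₀, ·) ≥ −log (ρ ∘ j) − C(p₀)`). Proof: the
  smooth function `f = −log (u/(1 + C₁ u))`, `u = ρ ∘ j`, satisfies `|df|_g ≤ 1` on the collar
  `{u < κ}` (`|du|_g ≤ (1 + C₁ u)^{1/2} u` there); along a `C¹` path from `p` to `q` of length
  `< d(p, q) + ε`, after the last exit from the core `{u ≥ κ/2}` the path stays in the collar,
  so `f(q) − f(last exit point) ≤ length` (the tree's `ofReal_abs_sub_le_mul_length`), and `f` is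
  bounded on the core level `{u = κ/2}` and at `p` in terms of `−log u(p)`.

The other half `t ≤ r + C` (a path of controlled length along the gradient flow of `u`) is the
business of a sibling file.

## References

* G. Li, J. Qing, Y. Shi, *Gap phenomena and curvature estimates for conformally compact
  Einstein manifolds*, Trans. AMS 369 (2017), p. 11 (and Lemma 4.1). [LiQingShi2017]
* R. Mazzeo, *The Hodge cohomology of a conformally compact metric*, J. Diff. Geom. 28 (1988),
  §1 (`−log ρ` is a distance function up to bounded error).
-/

noncomputable section

open Bundle Set Filter Function Metric TopologicalSpace Manifold
open scoped Manifold ContDiff Topology ENNReal NNReal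

namespace Literature.Geometry.Riemannian

namespace ConformallyCompact

open Literature.Geometry.Lorentzian
open Literature.Geometry.Lorentzian.PseudoRiemannianMetric
open SimpleAH

set_option maxSynthPendingDepth 3

/-! ### One-variable lemmas and a chain rule -/

section Elementary

/-- Derivative of `F(s) = −log s + log (1 + C s)`: `F'(s) = −(s (1 + C s))⁻¹` (`s > 0`, `C ≥ 0`).
[folklore] -/
theorem hasDerivAt_neg_log_add_log {C s : ℝ} (hC : 0 ≤ C) (hs : 0 < s) :
    HasDerivAt (fun s ↦ -Real.log s + Real.log (1 + C * s)) (-(s * (1 + C * s))⁻¹) s := by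
  have h1 : 0 < 1 + C * s := by positivity
  have hlog : HasDerivAt (fun s ↦ Real.log (1 + C * s)) (C / (1 + C * s)) s := by
    have h := ((hasDerivAt_id s).const_mul C).const_add 1
    have h' : HasDerivAt (fun s ↦ 1 + C * s) C s := by simpa using h
    have := h'.log h1.ne'
    simpa [div_eq_mul_inv, mul_comm] using this
  have h2 := ((Real.hasDerivAt_log hs.ne').neg).add hlog
  refine h2.congr_deriv ?_
  field_simp
  ring

/-- `F(s) = −log s + log (1 + C s) = log (s⁻¹ + C)` is antitone on `(0, ∞)` for `C ≥ 0`.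
[folklore] -/
theorem neg_log_add_log_antitone {C a b : ℝ} (hC : 0 ≤ C) (ha : 0 < a) (hab : a ≤ b) :
    -Real.log b + Real.log (1 + C * b) ≤ -Real.log a + Real.log (1 + C * a) := by
  have hb : 0 < b := ha.trans_le hab
  have e1 : -Real.log b + Real.log (1 + C * b) = Real.log (b⁻¹ + C) := by
    rw [← Real.log_inv, ← Real.log_mul (inv_ne_zero hb.ne') (by positivity)]
    congr 1; field_simp
  have e2 : -Real.log a + Real.log (1 + C * a) = Real.log (a⁻¹ + C) := by
    rw [← Real.log_inv, ← Real.log_mul (inv_ne_zero ha.ne') (by positivity)]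
    congr 1; field_simp
  rw [e1, e2]
  exact Real.log_le_log (by positivity) (by gcongr)

/-- `log (1 + C s) ≥ 0` for `C, s ≥ 0`. [folklore] -/
theorem log_one_add_mul_nonneg {C s : ℝ} (hC : 0 ≤ C) (hs : 0 ≤ s) : 0 ≤ Real.log (1 + C * s) :=
  Real.log_nonneg (by nlinarith)

variable {E : Type*} [NormedAddCommGroup E] [NormedSpace ℝ E] {H : Type*} [TopologicalSpace H]
  {I : ModelWithCorners ℝ E H} {M : Type*} [TopologicalSpace M] [ChartedSpace H M]

/-- **Chain rule for a real function of a real function on a manifold**: if `F` has derivative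
`F'` at `u x` and `u` is differentiable at `x`, then `d(F ∘ u)_x v = F' · du_x v`. [folklore] -/
theorem mvfderiv_comp_apply_of_hasDerivAt {F : ℝ → ℝ} {F' : ℝ} {u : M → ℝ} {x : M}
    (hF : HasDerivAt F F' (u x)) (hu : MDifferentiableAt I 𝓘(ℝ, ℝ) u x) (v : TangentSpace I x) :
    mvfderiv I (F ∘ u) x v = F' * mvfderiv I u x v := by
  have h1 : HasMFDerivAt 𝓘(ℝ, ℝ) 𝓘(ℝ, ℝ) F (u x) ((1 : ℝ →L[ℝ] ℝ).smulRight F') :=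
    hF.hasFDerivAt.hasMFDerivAt
  have h2 := h1.comp x hu.hasMFDerivAt
  have h3 : mfderiv I 𝓘(ℝ, ℝ) (F ∘ u) x =
      ((1 : ℝ →L[ℝ] ℝ).smulRight F').comp (mfderiv I 𝓘(ℝ, ℝ) u x) := h2.mfderiv
  have e1 : mvfderiv I (F ∘ u) x v = mfderiv I 𝓘(ℝ, ℝ) (F ∘ u) x v := rfl
  rw [e1, h3]
  exact mul_comm (mvfderiv I u x v) F'

end Elementary

/-! ### The lower bound `t ≥ r − C` -/

section LowerBound

variable {n : ℕ}
  {N : Type*} [TopologicalSpace N] [ChartedSpace (EuclideanSpace ℝ (Fin (n + 1))) N]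
  [IsManifold (𝓡 (n + 1)) ∞ N]
  {X : Type*} [TopologicalSpace X] [ChartedSpace (EuclideanHalfSpace (n + 1)) X]
  [IsManifold (𝓡∂ (n + 1)) ∞ X] [CompactSpace X]

set_option maxHeartbeats 1600000 in
/-- **The distance function dominates `−log ρ` up to a constant** (Li–Qing–Shi 2017, p. 11:
"`u = r − t` is bounded", the half `t ≥ r − C`; Mazzeo 1988, §1). In the setting of the module
docstring (`g` a smooth Riemannian metric on the bulk `N`, compact `X`, `j`, `ρ`, `ḡ` of class
`C^{n'}`, `n' ≥ 1`, `j^* ḡ = (ρ ∘ j)² g`, unit normals along `ι(B) = ∂X`), there is a constant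
`C` with `log ρ(j p) − log ρ(j q) − C ≤ d_g(p, q)` for all `p q : N` (as extended reals).
[cite: LiQingShi2017, p. 11] -/
theorem exists_log_sub_log_sub_le_edist {n' : ℕ∞ω}
    (G : PseudoRiemannianMetric (𝓡 (n + 1)) ∞ (EuclideanSpace ℝ (Fin (n + 1)))
      (TangentSpace (𝓡 (n + 1)) : N → Type _)) (hG : G.IsRiemannian)
    (gb : PseudoRiemannianMetric (𝓡∂ (n + 1)) n' (EuclideanSpace ℝ (Fin (n + 1)))
      (TangentSpace (𝓡∂ (n + 1)) : X → Type _)) (hn' : 1 ≤ n') (hgb : gb.IsRiemannian)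
    {j : N → X} (hj : Manifold.IsSmoothEmbedding (𝓡 (n + 1)) (𝓡∂ (n + 1)) ∞ j)
    (hjr : range j = (𝓡∂ (n + 1)).interior X)
    {ρ : X → ℝ} (hρ : ContMDiff (𝓡∂ (n + 1)) 𝓘(ℝ, ℝ) ∞ ρ) (hρ0 : ∀ x, 0 ≤ ρ x)
    (hρb : ∀ x, ρ x = 0 ↔ x ∈ (𝓡∂ (n + 1)).boundary X)
    (hconf : ∀ (x : N) (v w : TangentSpace (𝓡 (n + 1)) x),
      gb.val (j x) (mfderiv (𝓡 (n + 1)) (𝓡∂ (n + 1)) j x v) (mfderiv (𝓡 (n + 1)) (𝓡∂ (n + 1)) j x w)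
        = ρ (j x) ^ 2 * G.val x v w)
    {B : Type*} (ι : B → X) (hιr : range ι = (𝓡∂ (n + 1)).boundary X)
    (hν : ∀ y : B, ∃ ν : TangentSpace (𝓡∂ (n + 1)) (ι y), gb.val (ι y) ν ν = 1 ∧
      ∀ a : TangentSpace (𝓡∂ (n + 1)) (ι y), gb.val (ι y) ν a = mfderiv (𝓡∂ (n + 1)) 𝓘(ℝ, ℝ) ρ (ι y) a) :
    ∃ C : ℝ, ∀ p q : N,
      ENNReal.ofReal (Real.log (ρ (j p)) - Real.log (ρ (j q)) - C) ≤ G.edist hG p q := by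
  letI := G.riemannianBundle hG
  -- the propagated normalisation
  obtain ⟨κ, C₁, hκ, hC₁, hN⟩ :=
    exists_normalization_off_boundary G gb hn' hgb hj hjr hρ hρ0 hρb hconf ι hιr hν
  -- the function `u = ρ ∘ j` and its positivity
  set u : N → ℝ := fun x ↦ ρ (j x) with hu
  have hupos : ∀ x, 0 < u x := by
    intro x
    have hx : j x ∈ (𝓡∂ (n + 1)).interior X := hjr ▸ mem_range_self x
    have hnb : j x ∉ (𝓡∂ (n + 1)).boundary X := fun hb ↦
      Set.disjoint_left.1 ModelWithCorners.disjoint_interior_boundary hx hb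
    exact lt_of_le_of_ne (hρ0 _) fun h0 ↦ hnb ((hρb _).1 h0.symm)
  have husmooth : ContMDiff (𝓡 (n + 1)) 𝓘(ℝ, ℝ) ∞ u := hρ.comp hj.contMDiff
  have hucont : Continuous u := husmooth.continuous
  have hud : ∀ x, MDifferentiableAt (𝓡 (n + 1)) 𝓘(ℝ, ℝ) u x :=
    fun x ↦ (husmooth x).mdifferentiableAt (by simp)
  -- an upper bound `u ≤ ρmax`, `ρmax ≥ 1`
  obtain ⟨R, hR⟩ := isCompact_univ.exists_bound_of_continuousOn (f := ρ) hρ.continuous.continuousOn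
  set ρmax : ℝ := max R 1 with hρmax
  have hρmax1 : 1 ≤ ρmax := le_max_right _ _
  have hρmax0 : 0 < ρmax := one_pos.trans_le hρmax1
  have huρ : ∀ x, u x ≤ ρmax := fun x ↦
    ((le_abs_self _).trans ((Real.norm_eq_abs _).symm.trans_le (hR (j x) (mem_univ _)))).trans
      (le_max_left _ _)
  -- the comparison function `f = F ∘ u`, `F s = -log s + log (1 + C₁ s)`
  set F : ℝ → ℝ := fun s ↦ -Real.log s + Real.log (1 + C₁ * s) with hF
  set f : N → ℝ := F ∘ u with hf
  have hFsmooth : ∀ s, 0 < s → ContDiffAt ℝ 1 F s := by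
    intro s hs
    have h1 : ContDiffAt ℝ 1 (fun s ↦ -Real.log s) s := (Real.contDiffAt_log.2 hs.ne').neg
    have h2 : ContDiffAt ℝ 1 (fun s ↦ Real.log (1 + C₁ * s)) s := by
      have h3 : ContDiffAt ℝ 1 (fun s ↦ 1 + C₁ * s) s :=
        contDiffAt_const.add (contDiffAt_const.mul contDiffAt_id)
      exact h3.log (by positivity)
    exact h1.add h2
  have hfsmooth : ContMDiff (𝓡 (n + 1)) 𝓘(ℝ, ℝ) 1 f := fun x ↦
    (hFsmooth (u x) (hupos x)).comp_contMDiffAt ((husmooth x).of_le (by simp))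
  -- the derivative bound `|df| ≤ |·|_g` on the collar `{u < κ}`
  have hdf : ∀ x, u x < κ → ∀ v : TangentSpace (𝓡 (n + 1)) x,
      |mvfderiv (𝓡 (n + 1)) f x v| ≤ (1 : ℝ≥0) * Real.sqrt (G.val x v v) := by
    intro x hxκ v
    have hux := hupos x
    have h1 : 0 < 1 + C₁ * u x := by positivity
    rw [NNReal.coe_one, one_mul, hf,
      mvfderiv_comp_apply_of_hasDerivAt (hasDerivAt_neg_log_add_log hC₁ hux) (hud x) v]
    obtain ⟨hN1, -⟩ := hN x hxκ
    have hsq := hN1 v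
    -- `|du v| ≤ √(1 + C₁ u) u √(G v v)`
    have hGv : 0 ≤ G.val x v v := by
      by_cases hv : v = 0
      · rw [hv]; simp
      · exact (hG x v hv).le
    set A : ℝ := Real.sqrt (1 + C₁ * u x) with hA
    set S : ℝ := Real.sqrt (G.val x v v) with hS
    have hS0 : 0 ≤ S := Real.sqrt_nonneg _
    have hdu : |mvfderiv (𝓡 (n + 1)) u x v| ≤ A * u x * S := by
      have h2 : |mvfderiv (𝓡 (n + 1)) u x v| = Real.sqrt ((mvfderiv (𝓡 (n + 1)) u x v) ^ 2) :=
        (Real.sqrt_sq_eq_abs _).symm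
      rw [h2]
      calc Real.sqrt ((mvfderiv (𝓡 (n + 1)) u x v) ^ 2)
          ≤ Real.sqrt ((1 + C₁ * u x) * u x ^ 2 * G.val x v v) := Real.sqrt_le_sqrt hsq
        _ = A * u x * S := by
            rw [Real.sqrt_mul (by positivity), Real.sqrt_mul (by positivity),
              Real.sqrt_sq hux.le]
    have hsq1 : 1 ≤ A := by
      rw [hA, Real.le_sqrt zero_le_one h1.le]
      nlinarith [mul_nonneg hC₁ hux.le]
    have hApos : 0 < A := one_pos.trans_le hsq1
    have hAA : A * A = 1 + C₁ * u x := Real.mul_self_sqrt h1.le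
    rw [abs_mul, abs_neg, abs_inv, abs_of_pos (mul_pos hux h1)]
    calc (u x * (1 + C₁ * u x))⁻¹ * |mvfderiv (𝓡 (n + 1)) u x v|
        ≤ (u x * (1 + C₁ * u x))⁻¹ * (A * u x * S) :=
          mul_le_mul_of_nonneg_left hdu (by positivity)
      _ = S / A := by
          rw [← hAA, ← div_eq_inv_mul, div_eq_div_iff (by positivity) (by positivity)]
          ring
      _ ≤ S / 1 := by gcongr
      _ = S := div_one _
  -- integrating the bound along a path staying in the collar
  have hpath : ∀ (γ : ℝ → N) (a : ℝ), a ≤ 1 → ContMDiffOn 𝓘(ℝ, ℝ) (𝓡 (n + 1)) 1 γ (Icc 0 1) →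
      (∀ s ∈ Icc a 1, u (γ s) < κ) → 0 ≤ a →
      ENNReal.ofReal (f (γ 1) - f (γ a)) ≤ G.length hG γ 0 1 := by
    intro γ a ha1 hγ hcoll ha0
    have h := ofReal_abs_sub_le_mul_length G hG isOpen_univ hfsmooth.contMDiffOn (L := 1) ha1
      (hγ.mono (Icc_subset_Icc_left ha0)) (mapsTo_univ _ _)
      (fun t ht v ↦ hdf (γ t) (hcoll t ht) v)
    rw [ENNReal.coe_one, one_mul] at h
    exact ((ENNReal.ofReal_le_ofReal (le_abs_self _)).trans h).trans
      (length_mono G hG γ ha0 le_rfl)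
  -- the level `κ' = κ/2` and the value of `F` there
  set κ' : ℝ := κ / 2 with hκ'
  have hκ'pos : 0 < κ' := half_pos hκ
  have hκ'lt : κ' < κ := half_lt_self hκ
  -- the constant
  set C : ℝ := max 0 (Real.log ρmax - Real.log κ') +
    max (Real.log (1 + C₁ * ρmax)) (Real.log (1 + C₁ * κ')) with hC
  refine ⟨C, fun p q ↦ ?_⟩
  -- the key estimate: `f q - max (f p) (F κ') ≤ d(p, q)`
  set Mp : ℝ := max (f p) (F κ') with hMp
  have key : ENNReal.ofReal (f q - Mp) ≤ G.edist hG p q := by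
    refine le_of_forall_gt_imp_ge_of_dense fun r hr ↦ ?_
    have hr' : riemannianEDist (𝓡 (n + 1)) p q < r := hr
    obtain ⟨γ, hγp, hγq, hγs, hγl⟩ := exists_lt_of_riemannianEDist_lt hr'
    have hγl' : G.length hG γ 0 1 < r := hγl
    have hφc : ContinuousOn (fun s ↦ -u (γ s)) (Icc 0 1) :=
      (hucont.comp_continuousOn hγs.continuousOn).neg
    by_cases hq : κ' ≤ u q
    · -- `q` in the core: `f q ≤ F κ' ≤ Mp`
      have h1 : f q ≤ F κ' := neg_log_add_log_antitone hC₁ hκ'pos hq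
      have h2 : f q - Mp ≤ 0 := by
        have : F κ' ≤ Mp := le_max_right _ _
        linarith
      rw [ENNReal.ofReal_of_nonpos h2]
      exact bot_le
    push Not at hq
    by_cases hcore : ∃ s ∈ Icc (0 : ℝ) 1, -u (γ s) ≤ -κ'
    · -- last exit from the core
      obtain ⟨s₀, hs₀, hs₀K, hafter⟩ := exists_last_exit hφc hcore
      have hs₀1 : s₀ < 1 := by
        rcases hs₀.2.eq_or_lt with h | h
        · exfalso
          rw [h, hγq] at hs₀K
          linarith
        · exact h
      -- `u (γ s₀) = κ'`
      have hle : -κ' ≤ -u (γ s₀) :=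
        le_of_forall_Ioc_le (φ := fun s ↦ -u (γ s)) hφc hs₀ hs₀1 fun s hs ↦ (hafter s hs).le
      have heq : u (γ s₀) = κ' := le_antisymm (by linarith) (by linarith)
      have hcoll : ∀ s ∈ Icc s₀ 1, u (γ s) < κ := by
        intro s hs
        rcases hs.1.eq_or_lt with h | h
        · rw [← h, heq]; exact hκ'lt
        · have := hafter s ⟨h, hs.2⟩
          linarith
      have h1 := hpath γ s₀ hs₀.2 hγs hcoll hs₀.1
      rw [hγq] at h1
      have h2 : f (γ s₀) ≤ Mp := by
        rw [hf, Function.comp_apply, heq]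
        exact le_max_right _ _
      calc ENNReal.ofReal (f q - Mp) ≤ ENNReal.ofReal (f q - f (γ s₀)) :=
            ENNReal.ofReal_le_ofReal (by linarith)
        _ ≤ G.length hG γ 0 1 := h1
        _ ≤ r := hγl'.le
    · -- the whole path lies in the collar
      push Not at hcore
      have hcoll : ∀ s ∈ Icc (0 : ℝ) 1, u (γ s) < κ := by
        intro s hs
        have := hcore s hs
        linarith
      have h1 := hpath γ 0 zero_le_one hγs hcoll le_rfl
      rw [hγq, hγp] at h1
      have h2 : f p ≤ Mp := le_max_left _ _
      calc ENNReal.ofReal (f q - Mp) ≤ ENNReal.ofReal (f q - f p) :=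
            ENNReal.ofReal_le_ofReal (by linarith)
        _ ≤ G.length hG γ 0 1 := h1
        _ ≤ r := hγl'.le
  -- bookkeeping of the constants
  refine (ENNReal.ofReal_le_ofReal ?_).trans key
  have hfq : -Real.log (u q) ≤ f q := by
    have := log_one_add_mul_nonneg hC₁ (hupos q).le
    show -Real.log (u q) ≤ -Real.log (u q) + Real.log (1 + C₁ * u q)
    linarith
  have hMp' : Mp ≤ -Real.log (u p) + C := by
    have hlogu : Real.log (u p) ≤ Real.log ρmax := Real.log_le_log (hupos p) (huρ p)
    have h1 : f p ≤ -Real.log (u p) + C := by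
      have h2 : Real.log (1 + C₁ * u p) ≤ Real.log (1 + C₁ * ρmax) :=
        Real.log_le_log (by nlinarith [hupos p]) (by nlinarith [huρ p])
      have h3 : Real.log (1 + C₁ * ρmax) ≤
          max (Real.log (1 + C₁ * ρmax)) (Real.log (1 + C₁ * κ')) := le_max_left _ _
      have h4 : (0 : ℝ) ≤ max 0 (Real.log ρmax - Real.log κ') := le_max_left _ _
      show -Real.log (u p) + Real.log (1 + C₁ * u p) ≤ -Real.log (u p) + C
      rw [hC]; linarith
    have h5 : F κ' ≤ -Real.log (u p) + C := by
      have h6 : -Real.log κ' ≤ -Real.log (u p) + max 0 (Real.log ρmax - Real.log κ') := by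
        have : Real.log ρmax - Real.log κ' ≤ max 0 (Real.log ρmax - Real.log κ') :=
          le_max_right _ _
        linarith
      have h7 : Real.log (1 + C₁ * κ') ≤
          max (Real.log (1 + C₁ * ρmax)) (Real.log (1 + C₁ * κ')) := le_max_right _ _
      show -Real.log κ' + Real.log (1 + C₁ * κ') ≤ -Real.log (u p) + C
      rw [hC]; linarith
    exact max_le h1 h5
  show Real.log (u p) - Real.log (u q) - C ≤ f q - Mp
  linarith

end LowerBound

end ConformallyCompact

end Literature.Geometry.Riemannian

end
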